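import Summits.HodgeConjecture.HodgeConjecture.Theorems.HeckePrymWeilWeilTwelvefoldsSqrtMinus7CmPartnerHalf
import Summits.HodgeConjecture.HodgeConjecture.Theorems.HeckePrymWeilWeilTwelvefoldsSqrtMinus7AimedFrame
import Literature.AlgebraicGeometry.Motives.HyperbolicWeilTypeProduct
import HarnessLib

/-!
# The aiming lemma of the product trick for `K = ℚ(√-7)` (`d = 7`, `n ≥ 1`) from Hodge–Riemann in degree one

Crux `WeilTwelvefoldsSqrtMinus7` (stmt-HodgeConjecture-1261), line `amnesic-secant-sheaves-split-fourteenfolds`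
(lead seat c1), registered sub-goal `aimedSplitProduct_seven_of_hodgeRiemann`. The Literature named fact
`Motives.exists_cmWeilSurface_aimedSplitProduct_of_ne_one_of_ne_three` (Markman arXiv:2509.23403 §11.5 Step 2;
van Geemen, LNM 1594, Lemma 5.2 (3), 5.3, 5.4; Schoen 1998 §10) at `d = 7`, in every half-dimension `n ≥ 1`,
in its `∃ B, ∀ A` shape, PROVED from ONE classical named fact — Hodge–Riemann in degree one for the
hyperplane class (Voisin I Thm. 6.32 at `k = 1`; the HYPOTHESIS of the theorem, stated on the carriers exactly as the
line's leaf stub `stub_hodgeRiemannDegreeOne`; nearest tree theorem: `IsKaehlerClass.hodgeRiemann_one_smul` of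
`HodgeTheory/HodgeRiemannDegreeOne`, from which it follows once the hyperplane class `e^*a` is identified with a real
multiple of the Fubini–Study Kähler class of `e`) — by composing the two halves landed for this line: the PARTNER half
`exists_cmWeilSurface_descentPair 7` (the CM curve `E = ℂ/(ℤ + ℤ√-7)` with `[√-7]`, its degree-one model,
the surface `B = E × E` with `ψ = (φ, -φ)` and its descent pair) and the AIMING half
`stub_aimedFrameOfModel` (S7b': for every Weil-type `(A, φ_A)` of dimension `2n ≥ 2` satisfying Hodge–Riemann in
degree one, `A × (E × E)` is hyperbolic for the `K`-symmetrised hyperplane class of a weighted Segre embedding).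
The case `n = 0` (a point times `E × E`) is not needed by any consumer (`p ≥ 7`, `n ≥ 1` in `AimedDescending`) and
is left out.
-/

noncomputable section

set_option linter.dupNamespace false

open CategoryTheory Complex
open Literature.AlgebraicGeometry Literature.AlgebraicGeometry.Motives
  Literature.AlgebraicGeometry.HodgeTheory Literature.AlgebraicTopology.SingularHomology

namespace Summit.HodgeConjecture.HodgeConjecture.Theorems.WeilTwelvefoldsSqrtMinus7.AmnesicSecantSheaves

/-- **The aiming lemma for `K = ℚ(√-7)` in every dimension `2n ≥ 2`, given Hodge–Riemann in degree one** (the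
hypothesis is Hodge–Riemann in degree one for hyperplane classes, on the carriers, VERBATIM the line's leaf stub): one CM
Weil surface `(B, ψ)` — `B = E × E`, `E = ℂ/(ℤ + ℤ√-7)`, `ψ = ([√-7], -[√-7])`, `dim B = 2`, `ψ ≫ ψ = -7` — with a
descent pair `(b₊, b₋, η)`, such that for every complex abelian `2n`-fold `(A, φ)`, `n ≥ 1`, `φ ≫ φ = -7`, carrying
a non-zero rational `(n,n)` Weil class, some projective embedding `e` of `A × B` and non-zero rational `a` make
`(A × B, φ × ψ)` of hyperbolic Weil type in half-dimension `n + 1` for `7·e^*a + (φ × ψ)^*e^*a`.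
[cite: Markman2025SurveySecant, §11.5 Step 2] [cite: vanGeemen1994HodgeAV, Lemma 5.2 (3), 5.3 and 5.4 (5.4.1)]
[cite: Schoen1998HodgeWeilAddendum, §10] -/
theorem aimedSplitProduct_seven_of_hodgeRiemann :
    (∀ ⦃d : ℕ⦄ ⦃X : SchemeOver ℂ⦄, IsSmoothProjective (d + 1) X →
      ∀ (e : ProjectiveEmbedding X) (a : complexBetti (projectiveSpace e.n ℂ) 2),
        IsRationalClass a → a ≠ 0 →
      ∀ (M : HodgeModel (d + 1) X), M.IsReal →
        ∃ ω₀ : complexBetti X (2 + 2 * d), IsRationalClass ω₀ ∧ ω₀ ≠ 0 ∧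
          ∀ x : complexBetti X 1, M.pullback 1 x ∈ M.hodgePQ 1 1 0 → x ≠ 0 →
            ∃ t : ℝ, 0 < t ∧
              Complex.I • polarizationPairingOne X (complexBetti.map e.ι 2 a) d x
                (conjClass (ComplexPoints X) 1 x) = (t : ℂ) • ω₀) →
    ∃ (B : AbelianVariety ℂ) (ψ : B ⟶ B), B.dim = 2 ∧ ψ ≫ ψ = -((7 : ℤ) • 𝟙 B) ∧
      (∃ bp bm η : complexBetti B.X 2,
        bp ∈ Module.End.eigenspace (complexBetti.map (𝟙 B + ψ).hom.hom.hom 2).hom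
              ((1 + Complex.I * (Real.sqrt (7 : ℝ) : ℂ)) ^ 2) ∧
        bm ∈ Module.End.eigenspace (complexBetti.map (𝟙 B + ψ).hom.hom.hom 2).hom
              ((1 - Complex.I * (Real.sqrt (7 : ℝ) : ℂ)) ^ 2) ∧
        IsRationalClass (bp + bm) ∧ IsOfHodgeType 2 B.X 2 1 1 (bp + bm) ∧
        η ∈ algebraicClasses B.X 1 ∧
        cupProduct (show 2 + 2 = 4 from rfl) bp η ≠ 0 ∧
        cupProduct (show 2 + 2 = 4 from rfl) bm η ≠ 0) ∧
      ∀ (n : ℕ) (A : AbelianVariety ℂ) (φ : A ⟶ A), 1 ≤ n → A.dim = 2 * n →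
        φ ≫ φ = -((7 : ℤ) • 𝟙 A) →
        (∃ c : complexBetti A.X (2 * n), c ≠ 0 ∧ IsRationalClass c ∧
          IsOfHodgeType (2 * n) A.X (2 * n) n n c ∧
          c ∈ Module.End.eigenspace (complexBetti.map (𝟙 A + φ).hom.hom.hom (2 * n)).hom
                ((1 + Complex.I * (Real.sqrt (7 : ℝ) : ℂ)) ^ (2 * n)) ⊔
              Module.End.eigenspace (complexBetti.map (𝟙 A + φ).hom.hom.hom (2 * n)).hom
                ((1 - Complex.I * (Real.sqrt (7 : ℝ) : ℂ)) ^ (2 * n))) →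
        ∃ (e : ProjectiveEmbedding (A.prod B).X) (a : complexBetti (projectiveSpace e.n ℂ) 2),
          IsRationalClass a ∧ a ≠ 0 ∧
          IsHyperbolicWeilType (A.prod B)
            (AbelianVariety.prodLift (AbelianVariety.fst A B ≫ φ) (AbelianVariety.snd A B ≫ ψ)) (n + 1)
            ((7 : ℂ) • complexBetti.map e.ι 2 a +
              complexBetti.map (AbelianVariety.prodLift (AbelianVariety.fst A B ≫ φ)
                (AbelianVariety.snd A B ≫ ψ)).hom.hom.hom 2 (complexBetti.map e.ι 2 a)) := by
  intro hHR
  obtain ⟨E, φ, x, hE, hφ, hxr, hxi, hxs, hM, hadd, hω, hH2, hBdim, hψ, hpair⟩ :=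
    exists_cmWeilSurface_descentPair 7 (by norm_num)
  have hφ' : φ ≫ φ = -((7 : ℤ) • 𝟙 E) := hφ
  refine ⟨E.prod E, _, hBdim, hψ, hpair, ?_⟩
  intro n A φA hn hA hφA hc
  -- Hodge–Riemann in degree one for `A` (dimension `2n = (2n-1) + 1`) from the hypothesis
  have hdim : A.dim = (2 * n - 1) + 1 := by rw [hA]; omega
  have hX : IsSmoothProjective ((2 * n - 1) + 1) A.X := isSmoothProjective_of_dim_eq' hdim
  have h2n : (2 * n - 1) + 1 = 2 * n := by omega
  have hHRA : ∀ (eA : ProjectiveEmbedding A.X) (aA : complexBetti (projectiveSpace eA.n ℂ) 2),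
      IsRationalClass aA → aA ≠ 0 → ∀ (MA : HodgeModel (2 * n) A.X), MA.IsReal →
        ∃ ω₀ : complexBetti A.X (2 + 2 * (2 * n - 1)), IsRationalClass ω₀ ∧ ω₀ ≠ 0 ∧
          ∀ y : complexBetti A.X 1, MA.pullback 1 y ∈ MA.hodgePQ 1 1 0 → y ≠ 0 →
            ∃ t : ℝ, 0 < t ∧
              Complex.I • polarizationPairingOne A.X (complexBetti.map eA.ι 2 aA) (2 * n - 1) y
                (conjClass (ComplexPoints A.X) 1 y) = (t : ℂ) • ω₀ := by
    rw [← h2n]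
    exact fun eA aA haA haA0 MA hMA => hHR hX eA aA haA haA0 MA hMA
  exact stub_aimedFrameOfModel E φ hE hφ' x _ hxr hxi hxs hM hadd hω hH2 n A φA hn hA hφA hc hHRA

end Summit.HodgeConjecture.HodgeConjecture.Theorems.WeilTwelvefoldsSqrtMinus7.AmnesicSecantSheaves

end
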